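import Summits.Ventures.Crystal3D.Theorems.StickyWulffConstantTextureLiminfTexShadowRowStripDefs
import HarnessLib

/-!
# TexShadow §2c — PRESENTATION FLIP of a plate (basal mirror / reversed Hägg word): the wall cell and the four parts'
# hypotheses are presentation-covariant, so the ROW-COVERED part pays in whichever presentation dominates
# (lane T, crux `TextureLiminf`, stmt-Ventures-19483; registered line `TexShadow` v6.12; cf-p1 g28 INBOX 18:44:51Z ask)

HONEST FRAMING. Venture `Summits/Ventures/Crystal3D` (cell `crystal3d-full`), helper `--supports` the crux `TextureLiminf`
(stmt-Ventures-19483) of `route-Ventures-StickyWulffConstant`, registered line `TexShadow`.  Rung credit only; F-C1 not moved.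
Pure proofs; no definition.

THE POINT (cf-p1 §86(117) DH).  The per-strip row flux `rowFlux` pays only on the `++` c-layers of the PRESENTED word; a plate
presented with `−−` layers (fcc with the all-`(−1)` word, the far half of a twin) is the SAME plate as its basal-mirror
presentation `(L ∘ M, s, σ♭)`, `σ♭ n = −σ(−n−1)` (19480-p2's `reversed_grain_mem`, T's `upFrame`/`upWord`), in which those layers
are `++`.  This file proves that every datum of the four parts transforms by the bilayer/slab re-indexing `i ↦ −i−1`:
* `stacking_flip`, `laySlab_flip`, `bilayer_flip` — same plate; slab `i` ↦ slab `−i−1`; bilayer `i` ↦ bilayer `−i−1`;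
* `isCLayer_reverse_iff` — layer `k` of `σ♭` is a `++` c-layer iff layer `−k` of `σ` is a `−−` layer;
* `bilayerWallAt_flip₁` / `bilayerWallAt_flip₂` — THE WALL CELL INEQUALITY IS PRESENTATION-INVARIANT (charge table re-indexed
  `c♭ i j = c (−i−1) j`, resp. `c i (−j−1)`; the slab-overlap `tsum` re-indexed along the involution);
* `bilayerFramesAt_flip`, `bilayerChargeAdmissible_flip₁/₂` — the hypotheses re-index the frame/origin/axis tables likewise;
* **`rowCov_flip₁` / `rowCov_flip₂`** — `BilayerWallRowCov OffR C R₀` (ALL presentations) pays the cell of `(L₁, σ₁ | L₂, σ₂)` as soon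
  as the FLIPPED presentation of plate 1 (resp. 2) is row-mix-dominated and off-reach: `BilayerWallDeficit` may be read «deficient in
  every presentation» at no cost (v6.13 may add `¬ RowMixDominated` of the flips to its hypotheses; glue unchanged).
WHAT THIS IS NOT: no statement about which plates are dominated after flipping (a twin plate keeps one `−−` half in either
presentation — the genuine (L3) content of `Deficit`); F-C1 not moved.
-/

noncomputable section

open scoped BigOperators InnerProductSpace ENNReal
open MeasureTheory Filter

namespace Summit.Ventures.Crystal3D.Cruxes.TextureLiminf.TexShadow

open Summit.Ventures.Crystal3D Summit.Ventures.Crystal3D.Theorems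
open Literature.MathematicalPhysics.StatisticalMechanics (barlowPos barlowStacking basalMirror haggLabel IsHaggSeq
  mem_barlowStacking_iff barlowPos_mem basalMirror_basalMirror basalMirror_apply_coord)

/-! ## The basal mirror on the model sets -/

/-- `(L ∘ M) r + s` images are `L`-images of mirror preimages. -/
theorem image_trans_basalMirror (L : E3 ≃ₗᵢ[ℝ] E3) (s : E3) (T : Set E3) :
    (fun r => (basalMirror.trans L) r + s) '' T = (fun r => L r + s) '' {r | basalMirror r ∈ T} := by
  ext q
  simp only [Set.mem_image, LinearIsometryEquiv.trans_apply, Set.mem_setOf_eq]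
  constructor
  · rintro ⟨r, hr, rfl⟩
    exact ⟨basalMirror r, by rw [basalMirror_basalMirror]; exact hr, rfl⟩
  · rintro ⟨r, hr, rfl⟩
    exact ⟨basalMirror r, hr, by rw [basalMirror_basalMirror]⟩

/-- The basal mirror maps the model stacking of `σ` onto that of the reversed word, layer `k ↦ −k`
(19480-p2's `basalMirror_barlowPos_eq_reverse`). -/
theorem basalMirror_mem_barlowStacking_iff (σ : ℤ → ℤ) (r : E3) :
    basalMirror r ∈ barlowStacking 1 (Real.sqrt (2 / 3)) (fun n => -σ (-n - 1)) ↔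
      r ∈ barlowStacking 1 (Real.sqrt (2 / 3)) σ := by
  constructor
  · intro h
    obtain ⟨k, i, j, hk⟩ := mem_barlowStacking_iff.1 h
    have e : r = basalMirror (basalMirror r) := (basalMirror_basalMirror r).symm
    rw [e, hk]
    have h2 := basalMirror_barlowPos_eq_reverse (fun n => -σ (-n - 1)) k i j
    rw [reverse_reverse] at h2
    exact mem_barlowStacking_iff.2 ⟨-k, i, j, h2⟩
  · intro h
    obtain ⟨k, i, j, rfl⟩ := mem_barlowStacking_iff.1 h
    exact mem_barlowStacking_iff.2 ⟨-k, i, j, basalMirror_barlowPos_eq_reverse σ k i j⟩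

/-- **Same plate**: the basal-mirror presentation with the reversed word is the same moved stacking. -/
theorem stacking_flip (L : E3 ≃ₗᵢ[ℝ] E3) (s : E3) (σ : ℤ → ℤ) :
    stacking (basalMirror.trans L) s (fun n => -σ (-n - 1)) = stacking L s σ := by
  unfold stacking
  rw [image_trans_basalMirror]
  congr 1
  ext r
  exact basalMirror_mem_barlowStacking_iff σ r

/-- **Slabs re-index**: slab `i` of the mirrored frame is slab `−i−1` of the frame. -/
theorem laySlab_flip (L : E3 ≃ₗᵢ[ℝ] E3) (s : E3) (i : ℤ) :
    laySlab (basalMirror.trans L) s i = laySlab L s (-i - 1) := by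
  unfold laySlab
  rw [image_trans_basalMirror]
  congr 1
  ext r
  simp only [Set.mem_setOf_eq, basalMirror_apply_coord, if_true]
  push_cast
  constructor <;> rintro ⟨h1, h2⟩ <;> constructor <;> nlinarith [Real.sqrt_nonneg (2 / 3)]

/-- **Bilayers re-index**: bilayer `i` of the mirrored presentation is bilayer `−i−1` of the presentation. -/
theorem bilayer_flip (L : E3 ≃ₗᵢ[ℝ] E3) (s : E3) (σ : ℤ → ℤ) (i : ℤ) :
    bilayer (basalMirror.trans L) s (fun n => -σ (-n - 1)) i = bilayer L s σ (-i - 1) := by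
  unfold bilayer
  rw [image_trans_basalMirror]
  congr 1
  ext r
  simp only [Set.mem_setOf_eq, basalMirror_mem_barlowStacking_iff, basalMirror_apply_coord, if_true]
  push_cast
  constructor
  · rintro ⟨h1, h2⟩
    refine ⟨h1, ?_⟩
    rcases h2 with h | h
    · right; linarith
    · left; linarith
  · rintro ⟨h1, h2⟩
    refine ⟨h1, ?_⟩
    rcases h2 with h | h
    · right; linarith
    · left; linarith

/-- Layer `k` of the reversed word is a `++` c-layer iff layer `−k` of the word is a `−−` layer (for a Hägg word). -/
theorem isCLayer_reverse_iff {σ : ℤ → ℤ} (hσ : IsHaggSeq σ) (k : ℤ) :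
    IsCLayer (fun n => -σ (-n - 1)) k ↔ (σ (-k) = -1 ∧ σ (-k - 1) = -1) := by
  unfold IsCLayer
  have e1 : -(k - 1) - 1 = -k := by ring
  simp only [e1]
  constructor
  · rintro ⟨h1, h2⟩
    exact ⟨by linarith, by linarith⟩
  · rintro ⟨h1, h2⟩
    have := hσ k
    exact ⟨by rw [h2]; norm_num, by rw [h1]; norm_num⟩

/-! ## The wall cell inequality is presentation-invariant -/

/-- The involution `n ↦ −n−1` of `ℤ`. -/
theorem revIdx_equiv_apply : ∃ e : ℤ ≃ ℤ, ∀ n, e n = -n - 1 :=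
  ⟨⟨fun n => -n - 1, fun n => -n - 1, fun n => by ring, fun n => by ring⟩, fun _ => rfl⟩

/-- **Flip of plate 1 in the cell inequality** (charge table re-indexed `c♭ i j = c (−i−1) j`). -/
theorem bilayerWallAt_flip₁ {C R₀ : ℝ} {σ₁ σ₂ : ℤ → ℤ} {L₁ L₂ : E3 ≃ₗᵢ[ℝ] E3} {s₁ s₂ : E3} {c : ℤ → ℤ → ℝ} :
    BilayerWallAt C R₀ (fun n => -σ₁ (-n - 1)) σ₂ (basalMirror.trans L₁) L₂ s₁ s₂ (fun i j => c (-i - 1) j) ↔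
      BilayerWallAt C R₀ σ₁ σ₂ L₁ L₂ s₁ s₂ c := by
  obtain ⟨e, he⟩ := revIdx_equiv_apply
  have key : ∀ ρ : ℝ,
      (∑' ij : ℤ × ℤ, c (-ij.1 - 1) ij.2 *
          (volume ({q : E3 | 0 ≤ q 2 ∧ q 2 ≤ 1 ∧ q 0 ^ 2 + q 1 ^ 2 ≤ ρ ^ 2} ∩
            laySlab L₁ s₁ (-ij.1 - 1) ∩ laySlab L₂ s₂ ij.2)).toReal) =
        ∑' ij : ℤ × ℤ, c ij.1 ij.2 *
          (volume ({q : E3 | 0 ≤ q 2 ∧ q 2 ≤ 1 ∧ q 0 ^ 2 + q 1 ^ 2 ≤ ρ ^ 2} ∩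
            laySlab L₁ s₁ ij.1 ∩ laySlab L₂ s₂ ij.2)).toReal := by
    intro ρ
    rw [← Equiv.tsum_eq (e.prodCongr (Equiv.refl ℤ))]
    have hr : ∀ n : ℤ, -(-n - 1) - 1 = n := fun n => by ring
    simp only [Equiv.prodCongr_apply, Prod.map, Equiv.refl_apply, he, hr]
  unfold BilayerWallAt
  simp only [stacking_flip, laySlab_flip, key]

/-- **Flip of plate 2 in the cell inequality** (charge table re-indexed `c♭ i j = c i (−j−1)`). -/
theorem bilayerWallAt_flip₂ {C R₀ : ℝ} {σ₁ σ₂ : ℤ → ℤ} {L₁ L₂ : E3 ≃ₗᵢ[ℝ] E3} {s₁ s₂ : E3} {c : ℤ → ℤ → ℝ} :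
    BilayerWallAt C R₀ σ₁ (fun n => -σ₂ (-n - 1)) L₁ (basalMirror.trans L₂) s₁ s₂ (fun i j => c i (-j - 1)) ↔
      BilayerWallAt C R₀ σ₁ σ₂ L₁ L₂ s₁ s₂ c := by
  obtain ⟨e, he⟩ := revIdx_equiv_apply
  have key : ∀ ρ : ℝ,
      (∑' ij : ℤ × ℤ, c ij.1 (-ij.2 - 1) *
          (volume ({q : E3 | 0 ≤ q 2 ∧ q 2 ≤ 1 ∧ q 0 ^ 2 + q 1 ^ 2 ≤ ρ ^ 2} ∩
            laySlab L₁ s₁ ij.1 ∩ laySlab L₂ s₂ (-ij.2 - 1))).toReal) =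
        ∑' ij : ℤ × ℤ, c ij.1 ij.2 *
          (volume ({q : E3 | 0 ≤ q 2 ∧ q 2 ≤ 1 ∧ q 0 ^ 2 + q 1 ^ 2 ≤ ρ ^ 2} ∩
            laySlab L₁ s₁ ij.1 ∩ laySlab L₂ s₂ ij.2)).toReal := by
    intro ρ
    rw [← Equiv.tsum_eq ((Equiv.refl ℤ).prodCongr e)]
    have hr : ∀ n : ℤ, -(-n - 1) - 1 = n := fun n => by ring
    simp only [Equiv.prodCongr_apply, Prod.map, Equiv.refl_apply, he, hr]
  unfold BilayerWallAt
  simp only [stacking_flip, laySlab_flip, key]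

/-! ## The hypotheses of the four parts are presentation-covariant -/

/-- Bilayer frames with origins, re-indexed. -/
theorem bilayerFramesAt_flip {L : E3 ≃ₗᵢ[ℝ] E3} {s : E3} {σ : ℤ → ℤ} {A : ℤ → (E3 ≃ₗᵢ[ℝ] E3)} {u : ℤ → E3}
    (h : BilayerFramesAt L s σ A u) :
    BilayerFramesAt (basalMirror.trans L) s (fun n => -σ (-n - 1)) (fun i => A (-i - 1)) (fun i => u (-i - 1)) := by
  intro i
  rw [bilayer_flip]
  exact h (-i - 1)

/-- Admissible charge tables, plate 1 re-indexed. -/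
theorem bilayerChargeAdmissible_flip₁ {A₁ A₂ : ℤ → (E3 ≃ₗᵢ[ℝ] E3)} {c : ℤ → ℤ → ℝ} {m : ℤ → ℤ → E3}
    (h : BilayerChargeAdmissible A₁ A₂ c m) :
    BilayerChargeAdmissible (fun i => A₁ (-i - 1)) A₂ (fun i j => c (-i - 1) j) (fun i j => m (-i - 1) j) :=
  ⟨fun _ _ => h.1 _ _, fun _ _ => h.2.1 _ _, fun _ _ => h.2.2.1 _ _, fun _ _ => h.2.2.2 _ _⟩

/-- Admissible charge tables, plate 2 re-indexed. -/
theorem bilayerChargeAdmissible_flip₂ {A₁ A₂ : ℤ → (E3 ≃ₗᵢ[ℝ] E3)} {c : ℤ → ℤ → ℝ} {m : ℤ → ℤ → E3}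
    (h : BilayerChargeAdmissible A₁ A₂ c m) :
    BilayerChargeAdmissible A₁ (fun j => A₂ (-j - 1)) (fun i j => c i (-j - 1)) (fun i j => m i (-j - 1)) :=
  ⟨fun _ _ => h.1 _ _, fun _ _ => h.2.1 _ _, fun _ _ => h.2.2.1 _ _, fun _ _ => h.2.2.2 _ _⟩

/-! ## The row-covered part pays in the flipped presentation -/

/-- **ROW-COVERED, plate 1 flipped**: if `BilayerWallRowCov OffR C R₀` holds (all presentations) and the basal-mirror presentation
`(L₁ ∘ M, σ₁♭)` of plate 1 makes the table row-mix-dominated and the pair off-reach, then the cell inequality holds for the ORIGINAL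
presentation (and its charge table). -/
theorem rowCov_flip₁ {OffR : (E3 ≃ₗᵢ[ℝ] E3) → E3 → (ℤ → ℤ) → (E3 ≃ₗᵢ[ℝ] E3) → E3 → (ℤ → ℤ) → Prop} {C R₀ : ℝ}
    (hRC : BilayerWallRowCov OffR C R₀) {σ₁ σ₂ : ℤ → ℤ} (hσ₁ : IsHaggSeq σ₁) (hσ₂ : IsHaggSeq σ₂)
    {L₁ L₂ : E3 ≃ₗᵢ[ℝ] E3} {s₁ s₂ : E3} {A₁ A₂ : ℤ → (E3 ≃ₗᵢ[ℝ] E3)} {u₁ u₂ : ℤ → E3}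
    (hF₁ : BilayerFramesAt L₁ s₁ σ₁ A₁ u₁) (hF₂ : BilayerFramesAt L₂ s₂ σ₂ A₂ u₂)
    (hres : ∀ i j : ℤ, ¬ InResidualClass (A₁ i) (A₂ j) (u₁ i) (u₂ j))
    {c : ℤ → ℤ → ℝ} {m : ℤ → ℤ → E3} (hadm : BilayerChargeAdmissible A₁ A₂ c m)
    (hdom : RowMixDominated (Real.sqrt 2 / 2) (basalMirror.trans L₁) (fun n => -σ₁ (-n - 1)) L₂ σ₂ (fun i j => c (-i - 1) j))
    (hoff : OffR (basalMirror.trans L₁) s₁ (fun n => -σ₁ (-n - 1)) L₂ s₂ σ₂) :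
    BilayerWallAt C R₀ σ₁ σ₂ L₁ L₂ s₁ s₂ c :=
  bilayerWallAt_flip₁.1
    (hRC _ _ (isHaggSeq_reverse hσ₁) hσ₂ _ _ _ _ _ _ _ _ (bilayerFramesAt_flip hF₁) hF₂ (fun _ _ => hres _ _) _ _
      (bilayerChargeAdmissible_flip₁ hadm) hdom hoff)

/-- **ROW-COVERED, plate 2 flipped.** -/
theorem rowCov_flip₂ {OffR : (E3 ≃ₗᵢ[ℝ] E3) → E3 → (ℤ → ℤ) → (E3 ≃ₗᵢ[ℝ] E3) → E3 → (ℤ → ℤ) → Prop} {C R₀ : ℝ}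
    (hRC : BilayerWallRowCov OffR C R₀) {σ₁ σ₂ : ℤ → ℤ} (hσ₁ : IsHaggSeq σ₁) (hσ₂ : IsHaggSeq σ₂)
    {L₁ L₂ : E3 ≃ₗᵢ[ℝ] E3} {s₁ s₂ : E3} {A₁ A₂ : ℤ → (E3 ≃ₗᵢ[ℝ] E3)} {u₁ u₂ : ℤ → E3}
    (hF₁ : BilayerFramesAt L₁ s₁ σ₁ A₁ u₁) (hF₂ : BilayerFramesAt L₂ s₂ σ₂ A₂ u₂)
    (hres : ∀ i j : ℤ, ¬ InResidualClass (A₁ i) (A₂ j) (u₁ i) (u₂ j))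
    {c : ℤ → ℤ → ℝ} {m : ℤ → ℤ → E3} (hadm : BilayerChargeAdmissible A₁ A₂ c m)
    (hdom : RowMixDominated (Real.sqrt 2 / 2) L₁ σ₁ (basalMirror.trans L₂) (fun n => -σ₂ (-n - 1)) (fun i j => c i (-j - 1)))
    (hoff : OffR L₁ s₁ σ₁ (basalMirror.trans L₂) s₂ (fun n => -σ₂ (-n - 1))) :
    BilayerWallAt C R₀ σ₁ σ₂ L₁ L₂ s₁ s₂ c :=
  bilayerWallAt_flip₂.1
    (hRC _ _ hσ₁ (isHaggSeq_reverse hσ₂) _ _ _ _ _ _ _ _ hF₁ (bilayerFramesAt_flip hF₂) (fun _ _ => hres _ _) _ _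
      (bilayerChargeAdmissible_flip₂ hadm) hdom hoff)

/-- **ROW-COVERED, both plates flipped.** -/
theorem rowCov_flip₁₂ {OffR : (E3 ≃ₗᵢ[ℝ] E3) → E3 → (ℤ → ℤ) → (E3 ≃ₗᵢ[ℝ] E3) → E3 → (ℤ → ℤ) → Prop} {C R₀ : ℝ}
    (hRC : BilayerWallRowCov OffR C R₀) {σ₁ σ₂ : ℤ → ℤ} (hσ₁ : IsHaggSeq σ₁) (hσ₂ : IsHaggSeq σ₂)
    {L₁ L₂ : E3 ≃ₗᵢ[ℝ] E3} {s₁ s₂ : E3} {A₁ A₂ : ℤ → (E3 ≃ₗᵢ[ℝ] E3)} {u₁ u₂ : ℤ → E3}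
    (hF₁ : BilayerFramesAt L₁ s₁ σ₁ A₁ u₁) (hF₂ : BilayerFramesAt L₂ s₂ σ₂ A₂ u₂)
    (hres : ∀ i j : ℤ, ¬ InResidualClass (A₁ i) (A₂ j) (u₁ i) (u₂ j))
    {c : ℤ → ℤ → ℝ} {m : ℤ → ℤ → E3} (hadm : BilayerChargeAdmissible A₁ A₂ c m)
    (hdom : RowMixDominated (Real.sqrt 2 / 2) (basalMirror.trans L₁) (fun n => -σ₁ (-n - 1))
      (basalMirror.trans L₂) (fun n => -σ₂ (-n - 1)) (fun i j => c (-i - 1) (-j - 1)))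
    (hoff : OffR (basalMirror.trans L₁) s₁ (fun n => -σ₁ (-n - 1)) (basalMirror.trans L₂) s₂ (fun n => -σ₂ (-n - 1))) :
    BilayerWallAt C R₀ σ₁ σ₂ L₁ L₂ s₁ s₂ c :=
  bilayerWallAt_flip₁.1
    (rowCov_flip₂ hRC (isHaggSeq_reverse hσ₁) hσ₂ (bilayerFramesAt_flip hF₁) hF₂ (fun _ _ => hres _ _)
      (bilayerChargeAdmissible_flip₁ hadm) hdom hoff)

/-! ## The on-reach part in the flipped presentation (appended) -/

/-- **ON-REACH, plate 1 flipped**: `BilayerWallOnReachAll OffR C R₀` (all presentations) pays the cell of `(L₁, σ₁ | L₂, σ₂)` as soon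
as the on-reach hypothesis holds for the basal-mirror presentation of plate 1 (charge table re-indexed). -/
theorem onReachAll_flip₁ {OffR : (E3 ≃ₗᵢ[ℝ] E3) → E3 → (ℤ → ℤ) → (E3 ≃ₗᵢ[ℝ] E3) → E3 → (ℤ → ℤ) → Prop} {C R₀ : ℝ}
    (hOR : BilayerWallOnReachAll OffR C R₀) {σ₁ σ₂ : ℤ → ℤ} (hσ₁ : IsHaggSeq σ₁) (hσ₂ : IsHaggSeq σ₂)
    {L₁ L₂ : E3 ≃ₗᵢ[ℝ] E3} {s₁ s₂ : E3} {A₁ A₂ : ℤ → (E3 ≃ₗᵢ[ℝ] E3)} {u₁ u₂ : ℤ → E3}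
    (hF₁ : BilayerFramesAt L₁ s₁ σ₁ A₁ u₁) (hF₂ : BilayerFramesAt L₂ s₂ σ₂ A₂ u₂)
    (hres : ∀ i j : ℤ, ¬ InResidualClass (A₁ i) (A₂ j) (u₁ i) (u₂ j))
    {c : ℤ → ℤ → ℝ} {m : ℤ → ℤ → E3} (hadm : BilayerChargeAdmissible A₁ A₂ c m)
    (hon : (DeltaSteep (basalMirror.trans L₁) e₃ ∧ DeltaSteep L₂ (-e₃) ∧
        FluxDominated (Real.sqrt 2 / 2) (basalMirror.trans L₁) (fun n => -σ₁ (-n - 1)) L₂ σ₂ (fun i j => c (-i - 1) j) ∧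
        ¬ BarlowOffReach (basalMirror.trans L₁) s₁ (fun n => -σ₁ (-n - 1)) L₂ s₂ σ₂) ∨
      (RowMixDominated (Real.sqrt 2 / 2) (basalMirror.trans L₁) (fun n => -σ₁ (-n - 1)) L₂ σ₂ (fun i j => c (-i - 1) j) ∧
        ¬ OffR (basalMirror.trans L₁) s₁ (fun n => -σ₁ (-n - 1)) L₂ s₂ σ₂)) :
    BilayerWallAt C R₀ σ₁ σ₂ L₁ L₂ s₁ s₂ c :=
  bilayerWallAt_flip₁.1
    (hOR _ _ (isHaggSeq_reverse hσ₁) hσ₂ _ _ _ _ _ _ _ _ (bilayerFramesAt_flip hF₁) hF₂ (fun _ _ => hres _ _) _ _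
      (bilayerChargeAdmissible_flip₁ hadm) hon)

/-- **ON-REACH, plate 2 flipped.** -/
theorem onReachAll_flip₂ {OffR : (E3 ≃ₗᵢ[ℝ] E3) → E3 → (ℤ → ℤ) → (E3 ≃ₗᵢ[ℝ] E3) → E3 → (ℤ → ℤ) → Prop} {C R₀ : ℝ}
    (hOR : BilayerWallOnReachAll OffR C R₀) {σ₁ σ₂ : ℤ → ℤ} (hσ₁ : IsHaggSeq σ₁) (hσ₂ : IsHaggSeq σ₂)
    {L₁ L₂ : E3 ≃ₗᵢ[ℝ] E3} {s₁ s₂ : E3} {A₁ A₂ : ℤ → (E3 ≃ₗᵢ[ℝ] E3)} {u₁ u₂ : ℤ → E3}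
    (hF₁ : BilayerFramesAt L₁ s₁ σ₁ A₁ u₁) (hF₂ : BilayerFramesAt L₂ s₂ σ₂ A₂ u₂)
    (hres : ∀ i j : ℤ, ¬ InResidualClass (A₁ i) (A₂ j) (u₁ i) (u₂ j))
    {c : ℤ → ℤ → ℝ} {m : ℤ → ℤ → E3} (hadm : BilayerChargeAdmissible A₁ A₂ c m)
    (hon : (DeltaSteep L₁ e₃ ∧ DeltaSteep (basalMirror.trans L₂) (-e₃) ∧
        FluxDominated (Real.sqrt 2 / 2) L₁ σ₁ (basalMirror.trans L₂) (fun n => -σ₂ (-n - 1)) (fun i j => c i (-j - 1)) ∧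
        ¬ BarlowOffReach L₁ s₁ σ₁ (basalMirror.trans L₂) s₂ (fun n => -σ₂ (-n - 1))) ∨
      (RowMixDominated (Real.sqrt 2 / 2) L₁ σ₁ (basalMirror.trans L₂) (fun n => -σ₂ (-n - 1)) (fun i j => c i (-j - 1)) ∧
        ¬ OffR L₁ s₁ σ₁ (basalMirror.trans L₂) s₂ (fun n => -σ₂ (-n - 1)))) :
    BilayerWallAt C R₀ σ₁ σ₂ L₁ L₂ s₁ s₂ c :=
  bilayerWallAt_flip₂.1
    (hOR _ _ hσ₁ (isHaggSeq_reverse hσ₂) _ _ _ _ _ _ _ _ hF₁ (bilayerFramesAt_flip hF₂) (fun _ _ => hres _ _) _ _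
      (bilayerChargeAdmissible_flip₂ hadm) hon)

end Summit.Ventures.Crystal3D.Cruxes.TextureLiminf.TexShadow

end
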